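import Literature.MathematicalPhysics.QuantumLattice.EtaPairingOptimalGroundStates
import Literature.MathematicalPhysics.QuantumLattice.HubbardFerrimagneticOrder
import HarnessLib

/-!
# The Essler–Korepin–Schoutens model: `η`-pairing superconducting ground states for every
# attractive `U ≤ 0`, in every dimension

Topic `MathematicalPhysics/QuantumLattice` (family `hubbard`). Cell `pub/hubbard-cq`, seat
`hubbard-pc-lit-1`. WHAT THIS IS NOT: a statement about the plain Hubbard model; the EKS model is
the `U(2|2)`-supersymmetric nearest-neighbour extension of the Hubbard model (bond-charge,
pair-hopping, exchange and density interactions of fixed strength), finite volume, `T = 0`, zero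
field; uniqueness of the ground state is not claimed.

## The sources

* [EKS92] F. H. L. Essler, V. E. Korepin, K. Schoutens, *New exactly solvable model of strongly
  correlated electrons motivated by high-`T_c` superconductivity*, Phys. Rev. Lett. **68** (1992)
  2960 (arXiv:cond-mat/9209002): the model `H = H⁰ + U Σ_j (n_{j↑}-½)(n_{j↓}-½) + μ Σ_j n_j
  + h Σ_j (n_{j↑}-n_{j↓})`, `H⁰ = -Σ_{⟨jk⟩} H⁰_{jk}` on a general `d`-dimensional lattice, with the
  bond operator (their displayed formula for `H⁰_{j,k}`; `S_j = c†_{j↑} c_{j↓}`)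
  `H⁰_{jk} = Σ_σ (c†_{kσ} c_{jσ} + c†_{jσ} c_{kσ})(1 - n_{j,-σ} - n_{k,-σ}) + ½(n_j-1)(n_k-1)`
  `  + c†_{j↑}c†_{j↓}c_{k↓}c_{k↑} + c_{j↓}c_{j↑}c†_{k↑}c†_{k↓} - ½(n_{j↑}-n_{j↓})(n_{k↑}-n_{k↓})`
  `  - S†_j S_k - S_j S†_k + (n_{j↑}-½)(n_{j↓}-½) + (n_{k↑}-½)(n_{k↓}-½)`
  (a graded permutation of the four site states), and the observation that Yang's
  `Ψ_N = (η†)^N |0⟩`, `η† = Σ_j c†_{j↑} c†_{j↓}` (momentum zero), is an exact eigenstate with energy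
  `E = 2μN + UL/4 - M` (`M` the number of links) and the constant off-diagonal pair amplitude
  `N(L-N)/(L(L-1))`, i.e. ODLRO.
* [dBKS] J. de Boer, V. E. Korepin, A. Schadschneider, PRL **74** (1995) 789, p. 4: the EKS model is
  the generalized Hubbard model of de Boer–Schadschneider with `X = t = 1`, `V = -½`,
  `J_xy = J_z = 2`, `Y = -1` (the bond operator also carrying the on-site term
  `-(n_{j↑}-½)(n_{j↓}-½) - (n_{k↑}-½)(n_{k↓}-½)`), and by their ground-state inequality (8) "the
  sector I [`η`-pairing ground states] exists for all `U < 0` (in every dimension)"; the phase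
  diagram is that of Essler–Korepin–Schoutens, PRL **70** (1993) 73 [EKS93].

## What is formalised (everything PROVED, 0 named facts)

* `EKS.bondOp j k` = the displayed `H⁰_{jk}` [EKS92], `EKS.hamiltonian G U = -Σ_{⟨jk⟩} H⁰_{jk}
  + U Σ_x (n_{x↑}-½)(n_{x↓}-½)` on any finite simple graph;
* `EKS.bondOp_eq` — the dBKS identification `H⁰_{jk} = -h_{jk}(p_EKS)` with the tree's
  `GenHubbard.bondHamiltonian` at `p_EKS = (t, X, U, V, Y, J_xy, J_z, μ, Z) = (1, 1, -1, -½, -1, 2, 2, 0, 1)`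
  (two commutations of operators at distinct sites: `c_{j↓}c_{j↑} c†_{k↑}c†_{k↓} = c†_{k↑}c†_{k↓} c_{j↓}c_{j↑}`
  and the tree's `fermionSpinMinus_mul_fermionSpinPlus_of_ne`), `EKS.ogsInequalities` (the dBS inequalities (9) hold with equality
  margin `0` at `p_EKS`);
* `EKS.etaPairing_isGroundState`: for EVERY `U ≤ 0`, every finite graph and every `N ≤ |Λ|`, the
  momentum-zero `η`-pairing state `(η†)^N |0⟩` is a ground state of `EKS.hamiltonian G U` in the
  `2N`-particle sector, with sector ground energy `-#bonds + U |Λ|/4` (= `UL/4 - M` of [EKS92]);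
  `EKS.etaPairing_groundState_ODLRO`: its pair amplitude is `N(M'-N)/(M'(M'-1)) ‖ψ‖²` at every pair
  of distinct sites (`M' = |Λ|`). [cite: deBoerKorepinSchadschneider1995, p. 4]
-/

noncomputable section

namespace Literature.MathematicalPhysics.QuantumLattice

namespace EKS

open Matrix Finset HubbardWave0 GenHubbard
open scoped ComplexOrder

variable {Λ : Type*} [LinearOrder Λ] [Fintype Λ]

/-- **The Essler–Korepin–Schoutens bond operator** `H⁰_{jk}` (PRL 68 (1992) 2960, displayed
formula for `H⁰_{j,k}`; `S_j = c†_{j↑} c_{j↓}` = tree `fermionSpinPlus`, `S†_j` = `fermionSpinMinus`):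
`Σ_σ (c†_{kσ} c_{jσ} + c†_{jσ} c_{kσ})(1 - n_{j,-σ} - n_{k,-σ}) + ½(n_j-1)(n_k-1)`
`+ c†_{j↑}c†_{j↓}c_{k↓}c_{k↑} + c_{j↓}c_{j↑}c†_{k↑}c†_{k↓} - ½(n_{j↑}-n_{j↓})(n_{k↑}-n_{k↓})`
`- S†_j S_k - S_j S†_k + (n_{j↑}-½)(n_{j↓}-½) + (n_{k↑}-½)(n_{k↓}-½)`.
[cite: EsslerKorepinSchoutens1992, eq. for H⁰_{j,k}] -/
def bondOp (j k : Λ) : Matrix (Finset (Orb Λ)) (Finset (Orb Λ)) ℂ :=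
  (∑ σ : Fin 2, (creation (orb k σ) * annihilation (orb j σ) + creation (orb j σ) * annihilation (orb k σ)) *
      (1 - numberOp j (flipSpin σ) - numberOp k (flipSpin σ))) +
    (1 / 2 : ℂ) • ((siteNumber j - 1) * (siteNumber k - 1)) +
    (pairCre j * pairAnn k + pairAnn j * pairCre k) -
    (1 / 2 : ℂ) • ((numberOp j 0 - numberOp j 1) * (numberOp k 0 - numberOp k 1)) -
    (fermionSpinMinus j * fermionSpinPlus k + fermionSpinPlus j * fermionSpinMinus k) +
    (onSiteQ j + onSiteQ k)

variable (G : SimpleGraph Λ) [DecidableRel G.Adj]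

/-- **The Essler–Korepin–Schoutens Hamiltonian** at zero chemical potential and field:
`H = -Σ_{⟨jk⟩} H⁰_{jk} + U Σ_x (n_{x↑}-½)(n_{x↓}-½)` on a finite simple graph.
[cite: EsslerKorepinSchoutens1992, eq. for H and H⁰] -/
def hamiltonian (U : ℝ) : Matrix (Finset (Orb Λ)) (Finset (Orb Λ)) ℂ :=
  -(∑ j : Λ, ∑ k : Λ, if j < k ∧ G.Adj j k then bondOp j k else 0) + (U : ℂ) • ∑ x : Λ, onSiteQ x

/-- The de Boer–Korepin–Schadschneider parameters of the EKS bond operator: `t = X = 1`,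
`V = -½`, `Y = -1`, `J_xy = J_z = 2`, `μ = 0`, with the on-site share `U/Z = -1` carried by `H⁰`
itself. [cite: deBoerKorepinSchadschneider1995, p. 4] -/
def params : Params :=
  { t := 1, X := 1, U := -1, V := -1 / 2, Y := -1, Jxy := 2, Jz := 2, μ := 0, Z := 1 }

/-! ### Pair operators at distinct sites commute -/

/-- `c_{j↓}c_{j↑} c†_{k↑}c†_{k↓} = c†_{k↑}c†_{k↓} c_{j↓}c_{j↑}` for `j ≠ k` (pair operators at distinct
sites commute; tree `pairAnnihilation_pairCreation_comm`). [cite: EsslerEtAl2005, §2.1 eq. (2.2)] -/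
theorem pairAnn_mul_pairCre_of_ne {j k : Λ} (hjk : j ≠ k) :
    pairAnn j * pairCre k = pairCre k * pairAnn j := by
  refine ext_of_mulVec_single fun s => ?_
  rw [pairAnn, pairCre]
  conv_lhs => rw [← mulVec_mulVec]
  conv_rhs => rw [← mulVec_mulVec]
  exact EtaPairingODLRO.pairAnnihilation_pairCreation_comm hjk.symm _

/-- **The dBKS identification**: `H⁰_{jk} = -h_{jk}(p_EKS)` (`j ≠ k`).
[cite: deBoerKorepinSchadschneider1995, p. 4] -/
theorem bondOp_eq {j k : Λ} (hjk : j ≠ k) : bondOp j k = -GenHubbard.bondHamiltonian params j k := by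
  rw [bondOp, GenHubbard.bondHamiltonian, pairAnn_mul_pairCre_of_ne hjk,
    fermionSpinMinus_mul_fermionSpinPlus_of_ne hjk]
  simp only [hopFactor, fermionSpinZ, params, Fin.sum_univ_two, flipSpin_zero, flipSpin_one]
  push_cast
  simp only [smul_add, smul_sub, add_mul, mul_add, sub_mul, mul_sub, mul_one, one_mul, smul_mul_assoc,
    mul_smul_comm, neg_smul, one_smul, smul_smul, neg_add, neg_sub, neg_neg, mul_neg]
  norm_num
  abel

/-- The dBS inequalities (9) hold at `p_EKS` (all three with zero margin: `2|t| + 2V = 1 = -U/Z`,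
`V - J_z/4 = -1`, `V + |J_xy|/2 + J_z/4 = 1`). [cite: deBoerKorepinSchadschneider1995, eq. (8) and p. 4] -/
theorem ogsInequalities : OGSInequalities params where
  hV := by norm_num [params]
  hop := by norm_num [params]
  ferro := by norm_num [params]
  flip := by norm_num [params]

/-- The local energy of `p_EKS` is `-1` (so `-Σ_{⟨jk⟩} H⁰_{jk}` has the `η`-energy `-M`).
[cite: EsslerKorepinSchoutens1992, energy E = 2μN + UL/4 - M] -/
theorem localEnergy_params : localEnergy params = -1 := by norm_num [localEnergy, params]

/-- `EKS.hamiltonian = GenHubbard.hamiltonian p_EKS + U Σ_x (n_{x↑}-½)(n_{x↓}-½)`.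
[cite: deBoerKorepinSchadschneider1995, p. 4] -/
theorem hamiltonian_eq (U : ℝ) :
    hamiltonian G U = GenHubbard.hamiltonian G params + (U : ℂ) • ∑ x : Λ, onSiteQ x := by
  rw [hamiltonian, GenHubbard.hamiltonian]
  congr 1
  rw [← Finset.sum_neg_distrib]
  refine Finset.sum_congr rfl fun j _ => ?_
  rw [← Finset.sum_neg_distrib]
  refine Finset.sum_congr rfl fun k _ => ?_
  split_ifs with h
  · rw [bondOp_eq h.1.ne, neg_neg]
  · rw [neg_zero]

/-! ### The on-site term `U Σ_x (n_{x↑}-½)(n_{x↓}-½)` -/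

/-- `(n_{x↑}-½)(n_{x↓}-½)` is diagonal with entries `([x↑]-½)([x↓]-½) ∈ {±¼}`. [cite: EsslerKorepinSchoutens1992, eq. for H] -/
theorem onSiteQ_eq_diagonal (x : Λ) :
    onSiteQ x = diagonal fun α : Finset (Orb Λ) =>
      (((occ α (orb x 0) - 1 / 2) * (occ α (orb x 1) - 1 / 2) : ℝ) : ℂ) := by
  have h1 : (1 / 2 : ℂ) • (1 : Matrix (Finset (Orb Λ)) (Finset (Orb Λ)) ℂ) = diagonal fun _ => (1 / 2 : ℂ) := by
    rw [← diagonal_one, ← diagonal_smul]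
    congr 1
    funext α
    simp
  simp only [onSiteQ, numberOp_eq_diagonal, h1, diagonal_sub, diagonal_mul_diagonal]
  congr 1
  funext α
  push_cast
  ring

/-- `Re ⟨φ, (n_{x↑}-½)(n_{x↓}-½) φ⟩ ≤ ¼ ‖φ‖²`. [cite: EsslerKorepinSchoutens1992, eq. for H] -/
theorem re_expect_onSiteQ_le (x : Λ) (φ : Fock (Orb Λ)) :
    (star φ ⬝ᵥ (onSiteQ x *ᵥ φ)).re ≤ 1 / 4 * ∑ a, ‖φ a‖ ^ 2 := by
  rw [onSiteQ_eq_diagonal]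
  simp only [mulVec_diagonal, dotProduct, Pi.star_apply, Complex.re_sum, Finset.mul_sum]
  refine Finset.sum_le_sum fun α _ => ?_
  have hq : ((occ α (orb x 0) - 1 / 2) * (occ α (orb x 1) - 1 / 2) : ℝ) ≤ 1 / 4 := by
    rcases occ_eq_zero_or_one α (orb x 0) with h0 | h0 <;>
      rcases occ_eq_zero_or_one α (orb x 1) with h1 | h1 <;> rw [h0, h1] <;> norm_num
  have hre : (star (φ α) * ((((occ α (orb x 0) - 1 / 2) * (occ α (orb x 1) - 1 / 2) : ℝ) : ℂ) * φ α)).re =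
      ((occ α (orb x 0) - 1 / 2) * (occ α (orb x 1) - 1 / 2)) * ‖φ α‖ ^ 2 := by
    rw [mul_comm (star (φ α)), mul_assoc, Complex.star_def,
      Complex.mul_conj, Complex.normSq_eq_norm_sq, ← Complex.ofReal_mul, Complex.ofReal_re]
  rw [hre]
  exact mul_le_mul_of_nonneg_right hq (sq_nonneg _)

/-- On a vector supported on paired configurations `(n_{x↑}-½)(n_{x↓}-½)` acts as `+¼`.
[cite: EsslerKorepinSchoutens1992, energy E = 2μN + UL/4 - M] -/
theorem onSiteQ_mulVec_of_paired (x : Λ) {f : Fock (Orb Λ)} (hf : ∀ s, ¬IsPaired s → f s = 0) :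
    onSiteQ x *ᵥ f = (1 / 4 : ℂ) • f := by
  funext s
  rw [onSiteQ_eq_diagonal, mulVec_diagonal, Pi.smul_apply, smul_eq_mul]
  by_cases hs : IsPaired s
  · have h01 : occ s (orb x 0) = occ s (orb x 1) := by
      unfold occ
      by_cases h0 : orb x 0 ∈ s
      · rw [if_pos h0, if_pos ((hs x).1 h0)]
      · rw [if_neg h0, if_neg (fun h => h0 ((hs x).2 h))]
    rcases occ_eq_zero_or_one s (orb x 1) with h1 | h1 <;> rw [h01, h1] <;> push_cast <;> ring
  · rw [hf s hs, mul_zero, mul_zero]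

/-! ### The theorem -/

/-- **`η`-pairing ground states of the EKS model for every attractive `U ≤ 0`** (de Boer–Korepin–
Schadschneider, PRL 74 (1995) 789, p. 4: "the sector I exists for all `U < 0` (in every
dimension)"; phase diagram of Essler–Korepin–Schoutens, PRL 70 (1993) 73). On ANY finite simple
graph, for every `U ≤ 0` and every `N ≤ |Λ|`, the momentum-zero `η`-pairing state `(η†)^N |0⟩`,
`η† = Σ_x c†_{x↑} c†_{x↓}`, is a ground state of the EKS Hamiltonian in the `2N`-particle sector,
and the sector ground energy is `-#bonds + U|Λ|/4` (the `UL/4 - M` of EKS 1992).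
[cite: deBoerKorepinSchadschneider1995, p. 4] [cite: EsslerKorepinSchoutens1992, energy E = 2μN + UL/4 - M] -/
theorem etaPairing_isGroundState {U : ℝ} (hU : U ≤ 0) {N : ℕ} (hN : N ≤ Fintype.card Λ) :
    IsGroundState (hamiltonian G U) (2 * N) (etaPairingState (fun _ : Λ => (1 : ℤˣ)) N) ∧
      groundEnergy (hamiltonian G U) (2 * N) = -(bondCount G : ℝ) + U * Fintype.card Λ / 4 := by
  set ψ : Fock (Orb Λ) := etaPairingState (fun _ : Λ => (1 : ℤˣ)) N with hψ
  set E : ℝ := -(bondCount G : ℝ) + U * Fintype.card Λ / 4 with hE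
  have hY : ∀ j l : Λ, G.Adj j l →
      params.Y * ((((fun _ : Λ => (1 : ℤˣ)) j : ℤ) * ((fun _ : Λ => (1 : ℤˣ)) l : ℤ) : ℤ) : ℝ) =
        2 * params.V := by
    intro j l _; norm_num [params]
  have hf : ∀ s, ¬IsPaired s → ψ s = 0 := fun s hs => etaPairingState_apply_of_not_isPaired _ N hs
  -- the eigenvalue equation
  have hH0 : GenHubbard.hamiltonian G params *ᵥ ψ = ((-(bondCount G : ℝ) : ℝ) : ℂ) • ψ := by
    rw [hψ, GenHubbard.hamiltonian_mulVec_etaPairingState G params rfl rfl _ hY N, localEnergy_params, mul_neg_one]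
  have hQ : (∑ x : Λ, onSiteQ x) *ᵥ ψ = ((Fintype.card Λ / 4 : ℝ) : ℂ) • ψ := by
    rw [Matrix.sum_mulVec, Finset.sum_congr rfl fun x _ => onSiteQ_mulVec_of_paired x hf, Finset.sum_const,
      Finset.card_univ, ← Nat.cast_smul_eq_nsmul ℂ, smul_smul]
    push_cast
    ring_nf
  have hHψ : hamiltonian G U *ᵥ ψ = (E : ℂ) • ψ := by
    rw [hamiltonian_eq, add_mulVec, smul_mulVec, hH0, hQ, smul_smul, ← add_smul, hE]
    push_cast
    ring_nf
  have hψN : IsNParticle (2 * N) ψ := isNParticle_etaRaise_pow_mulVec_vacuum _ N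
  have hψ0 : ψ ≠ 0 := etaRaise_pow_mulVec_vacuum_ne_zero _ hN
  -- norms
  have hnorm : ∀ φ : Fock (Orb Λ), (star φ ⬝ᵥ φ).re = ∑ a, ‖φ a‖ ^ 2 := fun φ => by
    simp only [dotProduct, Pi.star_apply, Complex.re_sum]
    refine Finset.sum_congr rfl fun a _ => ?_
    rw [Complex.star_def, Complex.conj_mul', ← Complex.ofReal_pow, Complex.ofReal_re]
  -- upper bound
  have hpos : 0 < (star ψ ⬝ᵥ ψ).re := by
    rw [hnorm]
    obtain ⟨s, hs⟩ : ∃ s, ψ s ≠ 0 := Function.ne_iff.1 hψ0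
    exact lt_of_lt_of_le (by positivity) (Finset.single_le_sum (fun a _ => sq_nonneg ‖ψ a‖) (mem_univ s))
  have hle : groundEnergy (hamiltonian G U) (2 * N) ≤ E := by
    have h := LiebThm1.groundEnergy_mul_norm_le (hamiltonian G U) hψN
    rw [expect, hHψ, dotProduct_smul, smul_eq_mul, Complex.re_ofReal_mul] at h
    exact le_of_mul_le_mul_right h hpos
  -- lower bound: Gerschgorin part + on-site part
  have h2N : 2 * N ≤ Fintype.card (Orb Λ) := by rw [card_orb]; omega
  have hge : E ≤ groundEnergy (hamiltonian G U) (2 * N) := by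
    refine le_csInf (ThermodynamicLimit.groundEnergySet_nonempty _ h2N) ?_
    rintro e ⟨φ, -, hφ1, rfl⟩
    have hYabs : ∀ j l : Λ, G.Adj j l → |params.Y| ≤ -(2 * params.V) := by
      intro j l _; norm_num [params]
    have h1 := GenHubbard.hamiltonian_re_expect_ge G params ogsInequalities rfl hYabs rfl φ
    rw [localEnergy_params, ← hnorm φ, hφ1, Complex.one_re, mul_one, mul_neg_one] at h1
    have h2 : U * Fintype.card Λ / 4 ≤ (star φ ⬝ᵥ (((U : ℂ) • ∑ x : Λ, onSiteQ x) *ᵥ φ)).re := by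
      rw [smul_mulVec, dotProduct_smul, smul_eq_mul, Complex.re_ofReal_mul, Matrix.sum_mulVec,
        dotProduct_sum, Complex.re_sum]
      have h3 : ∑ x : Λ, (star φ ⬝ᵥ (onSiteQ x *ᵥ φ)).re ≤ Fintype.card Λ / 4 := by
        calc ∑ x : Λ, (star φ ⬝ᵥ (onSiteQ x *ᵥ φ)).re ≤ ∑ _x : Λ, (1 / 4 : ℝ) * ∑ a, ‖φ a‖ ^ 2 :=
              Finset.sum_le_sum fun x _ => re_expect_onSiteQ_le x φ
          _ = Fintype.card Λ / 4 := by
              rw [← hnorm φ, hφ1, Complex.one_re, Finset.sum_const, Finset.card_univ, nsmul_eq_mul]; ring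
      have := mul_le_mul_of_nonpos_left h3 hU
      linarith
    rw [expect, hamiltonian_eq, add_mulVec, dotProduct_add, Complex.add_re]
    linarith
  have heq : groundEnergy (hamiltonian G U) (2 * N) = E := le_antisymm hle hge
  exact ⟨⟨hψN, hψ0, by rw [heq, hHψ]⟩, heq⟩

/-- **ODLRO of the EKS ground states** (EKS 1992: `⟨ρ₂⟩_{off-diag} = N(L-N)/(L(L-1))`, "the fact
that this off-diagonal matrix element is constant for large distances establishes the property of
ODLRO"): under `U ≤ 0` the `2N`-particle ground state `ψ_N = (η†)^N |0⟩` has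
`⟨ψ_N, c†_{x↑} c†_{x↓} c_{y↓} c_{y↑} ψ_N⟩ = N(M-N)/(M(M-1)) ‖ψ_N‖²` for all `x ≠ y` (`M = |Λ|`).
[cite: EsslerKorepinSchoutens1992, eq. for the off-diagonal element of ρ₂] -/
theorem etaPairing_groundState_ODLRO {U : ℝ} (hU : U ≤ 0) {N : ℕ} (hN : N ≤ Fintype.card Λ)
    {x y : Λ} (hxy : x ≠ y) :
    IsGroundState (hamiltonian G U) (2 * N) (etaPairingState (fun _ : Λ => (1 : ℤˣ)) N) ∧
      pairAmplitude x y (etaPairingState (fun _ : Λ => (1 : ℤˣ)) N) =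
        ((yangPairAmplitude (Fintype.card Λ) N : ℝ) : ℂ) *
          (star (etaPairingState (fun _ : Λ => (1 : ℤˣ)) N) ⬝ᵥ etaPairingState (fun _ => 1) N) := by
  refine ⟨(etaPairing_isGroundState G hU hN).1, ?_⟩
  rw [pairAmplitude_etaPairingState (fun _ => 1) N hxy]
  simp

end EKS

end Literature.MathematicalPhysics.QuantumLattice
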